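import Summits.QuantumFields.YangMills.Theorems.SmallFieldWideningWindowCondCauchyCoupling
import Summits.QuantumFields.YangMills.Theorems.SmallFieldWideningAllHeightsSmallTiltPositivity

/-!
# Route SmallFieldWidening, crux `WindowCondCauchy` (stmt-QuantumFields-27825), line «via-tv» — THE JUNK GUARD OF THE COUPLING DOOR,
# PROVED: the conditioned unit laws `condUnitLaw` are genuine probability laws for small coupling

LINE g6-C (planner ym-idea-1 g6), answering the critic idea-crit-4 g4 note n5 (2026-08-28T13:08:48Z): the one open stub of «via-tv»,
`WindowCondCauchyCoupling.OneStepCoupling`, asks for PROBABILITY couplings of `condUnitLaw F γ b₀ p₀ K` and `… (K+1)`; were a window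
`histGood_K(0)` Gibbs-null, `condUnitLaw` would be `0` and the stub FALSE for a junk reason.  It is not, in the stub's own range: by the
landed window positivity `AllHeightsSmallTilt.gibbsK_histGood_pos` (width seat sfw-p2-w3), for every `L`, `b₀ > 0`, `p₀ > 2` there is
`0 < γ₁ ≤ 1` such that for every family with `F.L = L`, every `0 < γ ≤ γ₁` and every `K`, `condUnitLaw F γ b₀ p₀ K` IS a probability
measure (`isProbabilityMeasure_condUnitLaw`).  So the prover of `stub_oneStepCoupling` may shrink its `γ₁` below this one and work with
genuine laws ν_K.  Pure bookkeeping over landed theorems; no estimate of Bałaban's is asserted; no summit is proved (R3 is a record rung).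
-/

set_option autoImplicit false
open MeasureTheory
open Literature.MathematicalPhysics.QuantumFieldTheory.Balaban1983to89
open Literature.MathematicalPhysics.QuantumFieldTheory.Balaban1983to89.Missing
open Literature.MathematicalPhysics.QuantumFieldTheory.Balaban1983to89.T3ContinuumYM3Torus
open Literature.MathematicalPhysics.QuantumFieldTheory.Balaban1983to89.T3UnitLawDensityEML (ℰp measurableE_ℰp)
open Literature.MathematicalPhysics.QuantumFieldTheory.Balaban1983to89.T3UnitScaleTilt

namespace Summit.QuantumFields.YangMills.Theorems.WindowCondCauchyCoupling

/-- The total mass of the window unit law is the Gibbs mass of the window. -/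
theorem windowUnitLaw_univ (F : T3Family) (γ b₀ p₀ : ℝ) (K : ℕ) :
    windowUnitLaw F γ b₀ p₀ K Set.univ = gibbsK F ℰp γ K (histGood F ℰp (θBal F.L γ b₀ p₀) K 0) := by
  unfold windowUnitLaw
  rw [Measure.map_apply (measurable_unitA F ℰp measurableE_ℰp K) MeasurableSet.univ, Set.preimage_univ,
    Measure.restrict_apply MeasurableSet.univ, Set.univ_inter]

/-- The window unit law is a finite measure (`γ ≥ 0`). -/
theorem isFiniteMeasure_windowUnitLaw (F : T3Family) {γ : ℝ} (hγ : 0 ≤ γ) (b₀ p₀ : ℝ) (K : ℕ) :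
    IsFiniteMeasure (windowUnitLaw F γ b₀ p₀ K) := by
  haveI := isProbabilityMeasure_gibbsK F ℰp hγ K
  unfold windowUnitLaw
  infer_instance

/-- Normalising a measure of positive finite total mass gives a probability measure. -/
theorem isProbabilityMeasure_smul_inv {X : Type*} [MeasurableSpace X] (μ : Measure X)
    (h0 : μ Set.univ ≠ 0) (htop : μ Set.univ ≠ ⊤) : IsProbabilityMeasure ((μ Set.univ)⁻¹ • μ) :=
  ⟨by rw [Measure.smul_apply, smul_eq_mul, ENNReal.inv_mul_cancel h0 htop]⟩

/-- **THE JUNK GUARD, PROVED**: for small coupling the conditioned unit laws of the coupling door are probability measures. -/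
theorem isProbabilityMeasure_condUnitLaw :
    ∀ (L : ℕ) (b₀ p₀ : ℝ), 0 < b₀ → 2 < p₀ → ∃ γ₁ : ℝ, 0 < γ₁ ∧ γ₁ ≤ 1 ∧
      ∀ (F : T3Family) (γ : ℝ), F.L = L → 0 < γ → γ ≤ γ₁ → ∀ K : ℕ,
        IsProbabilityMeasure (condUnitLaw F γ b₀ p₀ K) := by
  intro L b₀ p₀ hb hp
  obtain ⟨γ₁, hγ₁, hγ₁1, H⟩ := AllHeightsSmallTilt.gibbsK_histGood_pos L b₀ p₀ hb hp
  refine ⟨γ₁, hγ₁, hγ₁1, fun F γ hFL hγ hγγ₁ K => ?_⟩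
  haveI := isFiniteMeasure_windowUnitLaw F hγ.le b₀ p₀ K
  have h0 : windowUnitLaw F γ b₀ p₀ K Set.univ ≠ 0 := by
    rw [windowUnitLaw_univ]; exact (H F γ hFL hγ hγγ₁ K).ne'
  exact isProbabilityMeasure_smul_inv _ h0 (measure_ne_top _ _)

/-- Hence the window mass is positive and finite in the same range (the form a coupling construction consumes). -/
theorem windowUnitLaw_univ_pos :
    ∀ (L : ℕ) (b₀ p₀ : ℝ), 0 < b₀ → 2 < p₀ → ∃ γ₁ : ℝ, 0 < γ₁ ∧ γ₁ ≤ 1 ∧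
      ∀ (F : T3Family) (γ : ℝ), F.L = L → 0 < γ → γ ≤ γ₁ → ∀ K : ℕ,
        0 < windowUnitLaw F γ b₀ p₀ K Set.univ ∧ windowUnitLaw F γ b₀ p₀ K Set.univ < ⊤ := by
  intro L b₀ p₀ hb hp
  obtain ⟨γ₁, hγ₁, hγ₁1, H⟩ := AllHeightsSmallTilt.gibbsK_histGood_pos L b₀ p₀ hb hp
  refine ⟨γ₁, hγ₁, hγ₁1, fun F γ hFL hγ hγγ₁ K => ⟨?_, ?_⟩⟩
  · rw [windowUnitLaw_univ]; exact H F γ hFL hγ hγγ₁ K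
  · haveI := isFiniteMeasure_windowUnitLaw F hγ.le b₀ p₀ K
    exact measure_lt_top _ _

end Summit.QuantumFields.YangMills.Theorems.WindowCondCauchyCoupling
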